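import Summits.QuantumFields.YangMills.Theorems.ColdStartUniversalityLatticeLangevinDossSussmannVectorODE
import Summits.QuantumFields.YangMills.Theorems.ColdStartUniversalityLatticeLangevinSynchronousCoupling
import Summits.QuantumFields.YangMills.Theorems.ColdStartUniversalityColdStartSolutionsExistPicardIntegrals
import HarnessLib

/-!
# Route `ColdStartUniversality` (fixed-cut-off SZZ dynamics; conjugation calculus, file 10):
# ★★ THE SZZ SOLUTION IS DETERMINED BY THE FREE BROWNIAN PATH — uniqueness for the Doss–Sussmann random ODE

Helper file (seat `ym-line-csu-p1`, g23).  With `B` the free (`β = 0`) solution family and `U` the solution family at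
coupling `β` (same flat noise), `V = (ρB)ᴴρU` solves the random ODE `V̇ = F_ω(t, V)`
(`hasDerivWithinAt_dossSussmann_vec`), whose field `F_ω(t, M)_e = (ρB_e(t))ᴴ D_β(e' ↦ ρB_{e'}(t) M_{e'})_e ρB_e(t) M_e`
depends on `ω` only through the continuous path `B(ω)`.  HERE: `F_ω(t, ·)` is LIPSCHITZ on the set `S` of
configurations with values in `ρ(SU(2))` (constant `K(L, β)`, uniform in `t, ω`: `lipschitzOnWith_dossSussmannField`),
hence (Mathlib `ODE_solution_unique_of_mem_Icc_right`) ★★ `dossSussmann_unique`: almost surely, EVERY `S`-valued path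
`V'` on `[0, T]` that solves `V̇' = F_ω(t, V')` from `V'(0) = (ρb)ᴴρx` coincides with `(ρB)ᴴρU` on `[0, T]` — the SZZ
solution from `x` is `B ·`(the unique solution of a deterministic ODE driven by the path `B`).  Consequence for the
smoothing programme (memo g23 §3): once a smooth deterministic flow `Φ^c` of this ODE is constructed for every continuous
path `c` (N1), `U^x_t = B_t Φ^{B}_t(x)` a.s. (N2) follows from this file with `V' := Φ^{B(ω)}`.
THEOREMS ONLY, no sorry.  HONEST FRAMING: fixed-cut-off calculus; nothing K-uniform; no crux, rung or summit statement is
proved; the Yang–Mills mass gap is NOT proved.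
-/

set_option autoImplicit false

noncomputable section

namespace Summit.QuantumFields.YangMills.Theorems.ColdStartUniversality

open MeasureTheory ProbabilityTheory Finset Filter
open scoped NNReal Matrix ComplexConjugate Topology
open Literature.Probability.Process Literature.MathematicalPhysics.QuantumFieldTheory
open Literature.MathematicalPhysics.QuantumLattice (fundamentalRep fundamentalLatticeRep continuous_fundamentalRep
  fundamentalRep_mem_unitaryGroup)

variable {L : ℕ}

/-! ## Hilbert–Schmidt lemmas (Frobenius scope local to this section) -/

section Frobenius

open scoped Matrix.Norms.Frobenius

/-- `‖A X‖_F² ≤ ‖A‖_F² ‖X‖_F²`. [folklore] -/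
theorem hsForm_mul_self_le {N : ℕ} (A X : Matrix (Fin N) (Fin N) ℂ) :
    hsForm N (A * X) (A * X) ≤ hsForm N A A * hsForm N X X := by
  rw [hsForm_self_eq_norm_sq, hsForm_self_eq_norm_sq, hsForm_self_eq_norm_sq, ← mul_pow]
  exact pow_le_pow_left₀ (norm_nonneg _) (norm_mul_le _ _) 2

end Frobenius

/-- **The Lie drift is bounded on the group** (in Hilbert–Schmidt norm). [folklore] -/
theorem exists_bound_hsForm_driftLie (L : ℕ) [NeZero L] (β : ℝ) :
    ∃ C : ℝ, 0 ≤ C ∧ ∀ (V : GaugeConfig 3 L (Matrix.specialUnitaryGroup (Fin 2) ℂ)) (e : Edge 3 L),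
      hsForm (fundamentalLatticeRep 2).N
        ((fundamentalLatticeRep 2).driftLie β (matrixConfig (fundamentalLatticeRep 2).ρ V) e)
        ((fundamentalLatticeRep 2).driftLie β (matrixConfig (fundamentalLatticeRep 2).ρ V) e) ≤ C := by
  have hcont : ∀ e : Edge 3 L, Continuous fun V : GaugeConfig 3 L (Matrix.specialUnitaryGroup (Fin 2) ℂ) =>
      hsForm (fundamentalLatticeRep 2).N
        ((fundamentalLatticeRep 2).driftLie β (matrixConfig (fundamentalLatticeRep 2).ρ V) e)
        ((fundamentalLatticeRep 2).driftLie β (matrixConfig (fundamentalLatticeRep 2).ρ V) e) := by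
    intro e
    have hD := continuous_driftLie_matrixConfig (L := L) β e
    simp only [hsForm_apply]
    exact Complex.continuous_re.comp ((hD.matrix_mul hD.matrix_conjTranspose).matrix_trace)
  have hbd : ∀ e : Edge 3 L, ∃ C, ∀ V : GaugeConfig 3 L (Matrix.specialUnitaryGroup (Fin 2) ℂ),
      hsForm (fundamentalLatticeRep 2).N
        ((fundamentalLatticeRep 2).driftLie β (matrixConfig (fundamentalLatticeRep 2).ρ V) e)
        ((fundamentalLatticeRep 2).driftLie β (matrixConfig (fundamentalLatticeRep 2).ρ V) e) ≤ C := by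
    intro e
    obtain ⟨C, hC⟩ := (isCompact_univ.image (hcont e)).isBounded.subset_closedBall_lt 0 0 |>.imp fun C h => h
    refine ⟨C, fun V => ?_⟩
    have hmem := hC.2 (Set.mem_image_of_mem _ (Set.mem_univ V))
    rw [Metric.mem_closedBall, dist_zero_right, Real.norm_eq_abs] at hmem
    exact (le_abs_self _).trans hmem
  choose Cb hCb using hbd
  refine ⟨∑ e, |Cb e|, sum_nonneg fun _ _ => abs_nonneg _, fun V e => ?_⟩
  exact ((hCb e V).trans (le_abs_self _)).trans
    (single_le_sum (f := fun e => |Cb e|) (fun _ _ => abs_nonneg _) (mem_univ e))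

/-! ## The Doss–Sussmann field is Lipschitz on `ρ(SU(2))`-valued configurations -/

/-- ★ **Lipschitz estimate for the Doss–Sussmann field on group-valued configurations** (Hilbert–Schmidt form): there is
`K₁ = K₁(L, β) ≥ 0` such that for every unitary "frame" configuration `c : GaugeConfig` and all `g, g' : GaugeConfig`,
`Σ_e ‖F_c(ρ∘g)_e − F_c(ρ∘g')_e‖_F² ≤ K₁ Σ_e ‖ρg_e − ρg'_e‖_F²`, where
`F_c(M)_e = (ρc_e)ᴴ · D_β(e' ↦ ρc_{e'} M_{e'})_e · ρc_e M_e`. [folklore] -/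
theorem dossSussmannField_lipschitz_hsForm (L : ℕ) [NeZero L] (β : ℝ) :
    ∃ K₁ : ℝ, 0 ≤ K₁ ∧ ∀ (c g g' : GaugeConfig 3 L (Matrix.specialUnitaryGroup (Fin 2) ℂ)),
      ∑ e, hsForm (fundamentalLatticeRep 2).N
        (((fundamentalLatticeRep 2).ρ (c e))ᴴ *
            (fundamentalLatticeRep 2).driftLie β (matrixConfig (fundamentalLatticeRep 2).ρ (c * g)) e *
            (fundamentalLatticeRep 2).ρ ((c * g) e) -
          ((fundamentalLatticeRep 2).ρ (c e))ᴴ *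
            (fundamentalLatticeRep 2).driftLie β (matrixConfig (fundamentalLatticeRep 2).ρ (c * g')) e *
            (fundamentalLatticeRep 2).ρ ((c * g') e))
        (((fundamentalLatticeRep 2).ρ (c e))ᴴ *
            (fundamentalLatticeRep 2).driftLie β (matrixConfig (fundamentalLatticeRep 2).ρ (c * g)) e *
            (fundamentalLatticeRep 2).ρ ((c * g) e) -
          ((fundamentalLatticeRep 2).ρ (c e))ᴴ *
            (fundamentalLatticeRep 2).driftLie β (matrixConfig (fundamentalLatticeRep 2).ρ (c * g')) e *
            (fundamentalLatticeRep 2).ρ ((c * g') e)) ≤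
      K₁ * ∑ e, hsForm (fundamentalLatticeRep 2).N
        ((fundamentalLatticeRep 2).ρ (g e) - (fundamentalLatticeRep 2).ρ (g' e))
        ((fundamentalLatticeRep 2).ρ (g e) - (fundamentalLatticeRep 2).ρ (g' e)) := by
  obtain ⟨K₀, hK₀, hLip⟩ := exists_lipschitz_driftDiff L β
  obtain ⟨CD, hCD, hD⟩ := exists_bound_hsForm_driftLie L β
  set r2 := fundamentalLatticeRep 2 with hr2
  have hρu : ∀ g : Matrix.specialUnitaryGroup (Fin 2) ℂ, r2.ρ g ∈ Matrix.unitaryGroup (Fin r2.N) ℂ := r2.mem_unitary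
  refine ⟨2 * K₀ + 2 * CD, by positivity, fun c g g' => ?_⟩
  -- abbreviations for the two product configurations
  have hW : ∀ e, (((r2.ρ (c e))ᴴ)ᴴ) * (r2.ρ (c e))ᴴ = 1 := fun e => by
    rw [Matrix.conjTranspose_conjTranspose, ← Matrix.star_eq_conjTranspose]
    exact Matrix.mem_unitaryGroup_iff.1 (hρu (c e))
  have hW' : ∀ e, (r2.ρ (c e))ᴴ * r2.ρ (c e) = 1 := fun e => by
    rw [← Matrix.star_eq_conjTranspose]; exact Matrix.mem_unitaryGroup_iff'.1 (hρu (c e))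
  have hmul : ∀ (h : GaugeConfig 3 L (Matrix.specialUnitaryGroup (Fin 2) ℂ)) (e : Edge 3 L),
      r2.ρ ((c * h) e) = r2.ρ (c e) * r2.ρ (h e) := fun h e => by
    rw [Pi.mul_apply, map_mul]
  -- per-link estimate
  have hlink : ∀ e : Edge 3 L,
      hsForm r2.N
        ((r2.ρ (c e))ᴴ * r2.driftLie β (matrixConfig r2.ρ (c * g)) e * r2.ρ ((c * g) e) -
          (r2.ρ (c e))ᴴ * r2.driftLie β (matrixConfig r2.ρ (c * g')) e * r2.ρ ((c * g') e))
        ((r2.ρ (c e))ᴴ * r2.driftLie β (matrixConfig r2.ρ (c * g)) e * r2.ρ ((c * g) e) -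
          (r2.ρ (c e))ᴴ * r2.driftLie β (matrixConfig r2.ρ (c * g')) e * r2.ρ ((c * g') e)) ≤
      2 * hsForm r2.N
          ((r2.driftLie β (matrixConfig r2.ρ (c * g)) e - r2.driftLie β (matrixConfig r2.ρ (c * g')) e) *
            r2.ρ ((c * g) e))
          ((r2.driftLie β (matrixConfig r2.ρ (c * g)) e - r2.driftLie β (matrixConfig r2.ρ (c * g')) e) *
            r2.ρ ((c * g) e)) +
        2 * CD * hsForm r2.N (r2.ρ (g e) - r2.ρ (g' e)) (r2.ρ (g e) - r2.ρ (g' e)) := by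
    intro e
    set D := r2.driftLie β (matrixConfig r2.ρ (c * g)) e with hDdef
    set D' := r2.driftLie β (matrixConfig r2.ρ (c * g')) e with hD'def
    set Q := r2.ρ ((c * g) e) with hQ
    set Q' := r2.ρ ((c * g') e) with hQ'
    -- `Wᴴ D Q − Wᴴ D' Q' = Wᴴ ((D − D') Q + D' (Q − Q'))`
    have hsplit : (r2.ρ (c e))ᴴ * D * Q - (r2.ρ (c e))ᴴ * D' * Q' =
        (r2.ρ (c e))ᴴ * ((D - D') * Q + D' * (Q - Q')) := by
      simp only [Matrix.mul_add, Matrix.sub_mul, Matrix.mul_sub, Matrix.mul_assoc]; abel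
    rw [hsplit, hsForm_mul_left_of_conjTranspose_mul_eq_one (hW e)]
    have h1 := hsForm_le_two_mul_add ((D - D') * Q + D' * (Q - Q')) (D' * (Q - Q'))
    rw [add_sub_cancel_right] at h1
    have h2 : hsForm r2.N (D' * (Q - Q')) (D' * (Q - Q')) ≤ CD * hsForm r2.N (r2.ρ (g e) - r2.ρ (g' e))
        (r2.ρ (g e) - r2.ρ (g' e)) := by
      have hQQ : Q - Q' = r2.ρ (c e) * (r2.ρ (g e) - r2.ρ (g' e)) := by
        rw [hQ, hQ', hmul, hmul, Matrix.mul_sub]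
      have h3 := hsForm_mul_self_le D' (Q - Q')
      rw [hQQ, hsForm_mul_left_of_conjTranspose_mul_eq_one (hW' e)] at h3
      rw [hQQ]
      exact h3.trans (mul_le_mul_of_nonneg_right (hD (c * g') e) (hsForm_self_nonneg _))
    linarith
  -- sum over links
  have hsum := sum_le_sum fun e (_ : e ∈ (univ : Finset (Edge 3 L))) => hlink e
  refine hsum.trans ?_
  rw [sum_add_distrib, ← mul_sum, ← mul_sum]
  have hL := hLip (c * g) (c * g')
  have hρΔ : ∀ e, hsForm r2.N (r2.ρ ((c * g) e) - r2.ρ ((c * g') e)) (r2.ρ ((c * g) e) - r2.ρ ((c * g') e)) =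
      hsForm r2.N (r2.ρ (g e) - r2.ρ (g' e)) (r2.ρ (g e) - r2.ρ (g' e)) := by
    intro e
    rw [hmul, hmul, ← Matrix.mul_sub, hsForm_mul_left_of_conjTranspose_mul_eq_one (hW' e)]
  simp_rw [hρΔ] at hL
  have hS0 : 0 ≤ ∑ e, hsForm r2.N (r2.ρ (g e) - r2.ρ (g' e)) (r2.ρ (g e) - r2.ρ (g' e)) :=
    sum_nonneg fun _ _ => hsForm_self_nonneg _
  nlinarith

/-! ## Uniqueness: the SZZ solution is a functional of the free Brownian path -/

/-- ★★ **Uniqueness for the Doss–Sussmann random ODE.**  `B` a regular solution family of the FREE dynamics (`β = 0`),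
`U` one at coupling `β`, same flat noise, starts `b, x`.  Almost surely: for every horizon `T ≥ 0` and every
configuration-valued path `V'` on `[0,T]` with values in `ρ(SU(2))^E`, continuous, solving `V̇' = F_ω(t, V')` (right
derivatives) from `V'(0) = (ρb)ᴴρx`, one has `V' = (ρB)ᴴρU` on `[0, T]`.  Here
`F_ω(t, M)_e = (ρB_e(t⁺))ᴴ D_β(e' ↦ ρB_{e'}(t⁺) M_{e'})_e ρB_e(t⁺) M_e`. [folklore] -/
theorem dossSussmann_unique (L : ℕ) [NeZero L] (β : ℝ) {Ω : Type} [MeasurableSpace Ω]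
    {P : Measure Ω} [IsProbabilityMeasure P] {W : ℝ≥0 → Ω → (Edge 3 L × NoiseIdx 2 → ℝ)} (hW : IsFlatBrownian W P)
    (B U : GaugeConfig 3 L (Matrix.specialUnitaryGroup (Fin 2) ℂ) → ℝ≥0 → Ω →
      GaugeConfig 3 L (Matrix.specialUnitaryGroup (Fin 2) ℂ))
    (hB : ∀ x, (∀ ω, B x 0 ω = x) ∧
      (latticeLangevinDynamics (fundamentalLatticeRep 2) 0).IsSolution (fundamentalRep (Fin 2)) hW.natFiltration P W (B x))
    (hBm : ∀ i : ℝ≥0, Measurable[@Prod.instMeasurableSpace (Set.Iic i)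
        (GaugeConfig 3 L (Matrix.specialUnitaryGroup (Fin 2) ℂ) × Ω) inferInstance
        (@Prod.instMeasurableSpace (GaugeConfig 3 L (Matrix.specialUnitaryGroup (Fin 2) ℂ)) Ω inferInstance
          (hW.natFiltration i))]
      (fun q : Set.Iic i × (GaugeConfig 3 L (Matrix.specialUnitaryGroup (Fin 2) ℂ) × Ω) => B q.2.1 q.1 q.2.2))
    (hU : ∀ x, (∀ ω, U x 0 ω = x) ∧
      (latticeLangevinDynamics (fundamentalLatticeRep 2) β).IsSolution (fundamentalRep (Fin 2)) hW.natFiltration P W (U x))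
    (hUm : ∀ i : ℝ≥0, Measurable[@Prod.instMeasurableSpace (Set.Iic i)
        (GaugeConfig 3 L (Matrix.specialUnitaryGroup (Fin 2) ℂ) × Ω) inferInstance
        (@Prod.instMeasurableSpace (GaugeConfig 3 L (Matrix.specialUnitaryGroup (Fin 2) ℂ)) Ω inferInstance
          (hW.natFiltration i))]
      (fun q : Set.Iic i × (GaugeConfig 3 L (Matrix.specialUnitaryGroup (Fin 2) ℂ) × Ω) => U q.2.1 q.1 q.2.2))
    (b x : GaugeConfig 3 L (Matrix.specialUnitaryGroup (Fin 2) ℂ)) :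
    ∀ᵐ ω ∂P, ∀ T : ℝ, 0 ≤ T →
      ∀ V' : ℝ → (Edge 3 L → Fin (fundamentalLatticeRep 2).N → Fin (fundamentalLatticeRep 2).N → ℂ),
        ContinuousOn V' (Set.Icc 0 T) →
        (∀ t ∈ Set.Ico 0 T, HasDerivWithinAt V'
          ((fun (s : ℝ) (M : Edge 3 L → Fin (fundamentalLatticeRep 2).N → Fin (fundamentalLatticeRep 2).N → ℂ)
              (e : Edge 3 L) (k l : Fin (fundamentalLatticeRep 2).N) =>
            (((fundamentalLatticeRep 2).ρ (B b s.toNNReal ω e))ᴴ *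
              (fundamentalLatticeRep 2).driftLie β
                (fun e' => (fundamentalLatticeRep 2).ρ (B b s.toNNReal ω e') * Matrix.of (M e')) e *
              ((fundamentalLatticeRep 2).ρ (B b s.toNNReal ω e) * Matrix.of (M e))) k l) t (V' t))
          (Set.Ici t) t) →
        (∀ t ∈ Set.Ico 0 T, ∃ g : GaugeConfig 3 L (Matrix.specialUnitaryGroup (Fin 2) ℂ),
          V' t = fun e k l => (fundamentalLatticeRep 2).ρ (g e) k l) →
        V' 0 = (fun (e : Edge 3 L) (k l : Fin (fundamentalLatticeRep 2).N) =>
          (((fundamentalLatticeRep 2).ρ (b e))ᴴ * (fundamentalLatticeRep 2).ρ (x e)) k l) →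
        Set.EqOn V' (fun (u : ℝ) (e : Edge 3 L) (k l : Fin (fundamentalLatticeRep 2).N) =>
          (((fundamentalLatticeRep 2).ρ (B b u.toNNReal ω e))ᴴ * (fundamentalLatticeRep 2).ρ (U x u.toNNReal ω e)) k l)
          (Set.Icc 0 T) := by
  obtain ⟨K₁, hK₁, hLip⟩ := dossSussmannField_lipschitz_hsForm L β
  have hρu : ∀ g : Matrix.specialUnitaryGroup (Fin 2) ℂ,
      (fundamentalLatticeRep 2).ρ g ∈ Matrix.unitaryGroup (Fin (fundamentalLatticeRep 2).N) ℂ :=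
    (fundamentalLatticeRep 2).mem_unitary
  -- the Lipschitz constant in the elementwise sup norm
  set cN : ℝ := (Fintype.card (Fin (fundamentalLatticeRep 2).N) : ℝ) with hcN
  set Kr : ℝ := Real.sqrt (K₁ * (Fintype.card (Edge 3 L) : ℝ) * (cN * cN)) with hKr
  have hKr0 : 0 ≤ Kr := Real.sqrt_nonneg _
  filter_upwards [hasDerivWithinAt_dossSussmann_vec L β hW B U hB hBm hU hUm b x, (hB b).2.continuous,
    (hU x).2.continuous] with ω hω hcB hcU T hT V' hV'c hV'd hV'S hV'0
  -- the field and the reference solution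
  set F : ℝ → (Edge 3 L → Fin (fundamentalLatticeRep 2).N → Fin (fundamentalLatticeRep 2).N → ℂ) →
      (Edge 3 L → Fin (fundamentalLatticeRep 2).N → Fin (fundamentalLatticeRep 2).N → ℂ) :=
    fun s M e k l => (((fundamentalLatticeRep 2).ρ (B b s.toNNReal ω e))ᴴ *
      (fundamentalLatticeRep 2).driftLie β
        (fun e' => (fundamentalLatticeRep 2).ρ (B b s.toNNReal ω e') * Matrix.of (M e')) e *
      ((fundamentalLatticeRep 2).ρ (B b s.toNNReal ω e) * Matrix.of (M e))) k l with hF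
  set V : ℝ → (Edge 3 L → Fin (fundamentalLatticeRep 2).N → Fin (fundamentalLatticeRep 2).N → ℂ) :=
    fun u e k l => (((fundamentalLatticeRep 2).ρ (B b u.toNNReal ω e))ᴴ *
      (fundamentalLatticeRep 2).ρ (U x u.toNNReal ω e)) k l with hV
  -- the field on group-valued configurations
  have hFgrp : ∀ (s : ℝ) (g : GaugeConfig 3 L (Matrix.specialUnitaryGroup (Fin 2) ℂ)) (e : Edge 3 L)
      (k l : Fin (fundamentalLatticeRep 2).N),
      F s (fun e k l => (fundamentalLatticeRep 2).ρ (g e) k l) e k l =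
        (((fundamentalLatticeRep 2).ρ ((fun e => B b s.toNNReal ω e) e))ᴴ *
          (fundamentalLatticeRep 2).driftLie β
            (matrixConfig (fundamentalLatticeRep 2).ρ ((fun e => B b s.toNNReal ω e) * g)) e *
          (fundamentalLatticeRep 2).ρ (((fun e => B b s.toNNReal ω e) * g) e)) k l := by
    intro s g e k l
    have hof : ∀ e', Matrix.of (fun k l => (fundamentalLatticeRep 2).ρ (g e') k l) = (fundamentalLatticeRep 2).ρ (g e') :=
      fun e' => Matrix.ext fun _ _ => rfl
    have hcfg : (fun e' => (fundamentalLatticeRep 2).ρ (B b s.toNNReal ω e') *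
        Matrix.of (fun k l => (fundamentalLatticeRep 2).ρ (g e') k l)) =
        matrixConfig (fundamentalLatticeRep 2).ρ ((fun e => B b s.toNNReal ω e) * g) := by
      funext e'; rw [hof, matrixConfig, Pi.mul_apply, map_mul]
    simp only [hF]
    rw [hcfg, hof, Pi.mul_apply, map_mul]
  -- Lipschitz on `S`
  have hLipF : ∀ s : ℝ, LipschitzOnWith (Real.toNNReal Kr) (F s)
      {M | ∃ g : GaugeConfig 3 L (Matrix.specialUnitaryGroup (Fin 2) ℂ),
        M = fun e k l => (fundamentalLatticeRep 2).ρ (g e) k l} := by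
    intro s
    refine LipschitzOnWith.of_dist_le_mul fun M hM M' hM' => ?_
    obtain ⟨g, rfl⟩ := hM
    obtain ⟨g', rfl⟩ := hM'
    rw [dist_eq_norm, dist_eq_norm, Real.coe_toNNReal _ (Real.sqrt_nonneg _)]
    set c : GaugeConfig 3 L (Matrix.specialUnitaryGroup (Fin 2) ℂ) := fun e => B b s.toNNReal ω e with hc
    have hsum := hLip c g g'
    -- the HS sum of the differences of the matrices `g e − g' e` is at most `|E| cN² ‖M − M'‖²`
    set δ : ℝ := ‖(fun e k l => (fundamentalLatticeRep 2).ρ (g e) k l) -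
        (fun e k l => (fundamentalLatticeRep 2).ρ (g' e) k l :
          Edge 3 L → Fin (fundamentalLatticeRep 2).N → Fin (fundamentalLatticeRep 2).N → ℂ)‖ with hδ
    have hδ0 : 0 ≤ δ := norm_nonneg _
    have hentry_le : ∀ e k l, ‖(fundamentalLatticeRep 2).ρ (g e) k l - (fundamentalLatticeRep 2).ρ (g' e) k l‖ ≤ δ := by
      intro e k l
      have h := norm_le_pi_norm ((fun e k l => (fundamentalLatticeRep 2).ρ (g e) k l) -
        (fun e k l => (fundamentalLatticeRep 2).ρ (g' e) k l :
          Edge 3 L → Fin (fundamentalLatticeRep 2).N → Fin (fundamentalLatticeRep 2).N → ℂ)) e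
      have h2 := (norm_le_pi_norm _ k).trans h
      have h3 := (norm_le_pi_norm _ l).trans h2
      simp only [Pi.sub_apply] at h3
      exact h3
    have hhs_le : ∀ e, hsForm (fundamentalLatticeRep 2).N
        ((fundamentalLatticeRep 2).ρ (g e) - (fundamentalLatticeRep 2).ρ (g' e))
        ((fundamentalLatticeRep 2).ρ (g e) - (fundamentalLatticeRep 2).ρ (g' e)) ≤ cN * cN * δ ^ 2 := by
      intro e
      rw [hsForm_self]
      calc ∑ k, ∑ l, ‖((fundamentalLatticeRep 2).ρ (g e) - (fundamentalLatticeRep 2).ρ (g' e)) k l‖ ^ 2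
          ≤ ∑ _k : Fin (fundamentalLatticeRep 2).N, ∑ _l : Fin (fundamentalLatticeRep 2).N, δ ^ 2 :=
            sum_le_sum fun k _ => sum_le_sum fun l _ => by
              rw [Matrix.sub_apply]; exact pow_le_pow_left₀ (norm_nonneg _) (hentry_le e k l) 2
        _ = cN * cN * δ ^ 2 := by simp [hcN]; ring
    have htot : ∑ e, hsForm (fundamentalLatticeRep 2).N
        ((fundamentalLatticeRep 2).ρ (g e) - (fundamentalLatticeRep 2).ρ (g' e))
        ((fundamentalLatticeRep 2).ρ (g e) - (fundamentalLatticeRep 2).ρ (g' e)) ≤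
        (Fintype.card (Edge 3 L) : ℝ) * (cN * cN * δ ^ 2) := by
      calc _ ≤ ∑ _e : Edge 3 L, cN * cN * δ ^ 2 := sum_le_sum fun e _ => hhs_le e
        _ = _ := by rw [sum_const, nsmul_eq_mul, Finset.card_univ]
    -- every entry of `F M − F M'` is bounded by `Kr δ`
    have hentryF : ∀ e k l, ‖F s (fun e k l => (fundamentalLatticeRep 2).ρ (g e) k l) e k l -
        F s (fun e k l => (fundamentalLatticeRep 2).ρ (g' e) k l) e k l‖ ≤ Kr * δ := by
      intro e k l
      have hsq : ‖F s (fun e k l => (fundamentalLatticeRep 2).ρ (g e) k l) e k l -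
          F s (fun e k l => (fundamentalLatticeRep 2).ρ (g' e) k l) e k l‖ ^ 2 ≤ (Kr * δ) ^ 2 := by
        rw [hFgrp, hFgrp, ← Matrix.sub_apply]
        refine (norm_entry_sq_le_hsForm _ k l).trans ?_
        refine (single_le_sum (f := fun e => hsForm (fundamentalLatticeRep 2).N
          (((fundamentalLatticeRep 2).ρ (c e))ᴴ *
              (fundamentalLatticeRep 2).driftLie β (matrixConfig (fundamentalLatticeRep 2).ρ (c * g)) e *
              (fundamentalLatticeRep 2).ρ ((c * g) e) -
            ((fundamentalLatticeRep 2).ρ (c e))ᴴ *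
              (fundamentalLatticeRep 2).driftLie β (matrixConfig (fundamentalLatticeRep 2).ρ (c * g')) e *
              (fundamentalLatticeRep 2).ρ ((c * g') e))
          (((fundamentalLatticeRep 2).ρ (c e))ᴴ *
              (fundamentalLatticeRep 2).driftLie β (matrixConfig (fundamentalLatticeRep 2).ρ (c * g)) e *
              (fundamentalLatticeRep 2).ρ ((c * g) e) -
            ((fundamentalLatticeRep 2).ρ (c e))ᴴ *
              (fundamentalLatticeRep 2).driftLie β (matrixConfig (fundamentalLatticeRep 2).ρ (c * g')) e *
              (fundamentalLatticeRep 2).ρ ((c * g') e))) (fun _ _ => hsForm_self_nonneg _) (mem_univ e)).trans ?_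
        refine hsum.trans ?_
        rw [mul_pow, hKr, Real.sq_sqrt (by positivity)]
        nlinarith [htot, hK₁]
      have hKδ : 0 ≤ Kr * δ := mul_nonneg hKr0 hδ0
      exact (abs_le_of_sq_le_sq' hsq hKδ).2
    have hKδ : 0 ≤ Kr * δ := mul_nonneg hKr0 hδ0
    refine (pi_norm_le_iff_of_nonneg (r := Kr * δ) hKδ).2 fun e => ?_
    refine (pi_norm_le_iff_of_nonneg (r := Kr * δ) hKδ).2 fun k => ?_
    refine (pi_norm_le_iff_of_nonneg (r := Kr * δ) hKδ).2 fun l => ?_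
    rw [Pi.sub_apply, Pi.sub_apply, Pi.sub_apply]
    exact hentryF e k l
  -- the reference solution: continuity, membership, derivative
  have hVc : Continuous V := by
    have h1 : ∀ e, Continuous fun u : ℝ => (fundamentalLatticeRep 2).ρ (B b u.toNNReal ω e) := fun e =>
      (fundamentalLatticeRep 2).continuous.comp ((continuous_apply e).comp (hcB.comp continuous_real_toNNReal))
    have h2 : ∀ e, Continuous fun u : ℝ => (fundamentalLatticeRep 2).ρ (U x u.toNNReal ω e) := fun e =>
      (fundamentalLatticeRep 2).continuous.comp ((continuous_apply e).comp (hcU.comp continuous_real_toNNReal))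
    refine continuous_pi fun e => continuous_pi fun k => continuous_pi fun l => ?_
    exact (continuous_apply l).comp ((continuous_apply k).comp (((h1 e).matrix_conjTranspose).matrix_mul (h2 e)))
  have hVS : ∀ t : ℝ, ∃ g : GaugeConfig 3 L (Matrix.specialUnitaryGroup (Fin 2) ℂ),
      V t = fun e k l => (fundamentalLatticeRep 2).ρ (g e) k l := by
    intro t
    refine ⟨fun e => (B b t.toNNReal ω e)⁻¹ * U x t.toNNReal ω e, ?_⟩
    have hρinv : ∀ h : Matrix.specialUnitaryGroup (Fin 2) ℂ,
        (fundamentalLatticeRep 2).ρ h⁻¹ = ((fundamentalLatticeRep 2).ρ h)ᴴ := fun h => rfl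
    funext e k l
    simp only [hV]
    rw [map_mul, hρinv]
  have hVd : ∀ t ∈ Set.Ico (0 : ℝ) T, HasDerivWithinAt V (F t (V t)) (Set.Ici t) t := fun t ht =>
    (hω t ht.1).mono (Set.Ici_subset_Ici.2 ht.1)
  -- uniqueness
  have huniq := ODE_solution_unique_of_mem_Icc_right (v := F) (K := Real.toNNReal Kr)
    (s := fun _ => {M | ∃ g : GaugeConfig 3 L (Matrix.specialUnitaryGroup (Fin 2) ℂ),
      M = fun e k l => (fundamentalLatticeRep 2).ρ (g e) k l})
    (f := V') (g := V) (a := 0) (b := T) (fun t _ => hLipF t) hV'c (fun t ht => hV'd t ht) (fun t ht => hV'S t ht)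
    hVc.continuousOn hVd (fun t _ => hVS t) ?_
  · exact huniq
  · rw [hV'0]
    funext e k l
    simp only [hV, Real.toNNReal_zero, (hB b).1 ω, (hU x).1 ω]

end Summit.QuantumFields.YangMills.Theorems.ColdStartUniversality

end
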